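import Summits.BirchSwinnertonDyer.BirchSwinnertonDyer.Theorems.ByReductionTypeAtTwoMultUpperHalf
import Summits.BirchSwinnertonDyer.Rank1Residual.X5.TwoAdicTargetsMultKatoInt
import Summits.BirchSwinnertonDyer.Rank1Residual.X5.TwoAdicTargetsEndStateClosed
import Summits.BirchSwinnertonDyer.Rank1Residual.X5.TwoAdicTargetsMultPubOdd
import Summits.BirchSwinnertonDyer.BirchSwinnertonDyer.Theorems.ByReductionTypeAtTwoMultUpperHalfKatoIntDefs
import Summits.BirchSwinnertonDyer.BirchSwinnertonDyer.Theorems.ByReductionTypeAtTwoMultUpperHalfDefs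
import Literature.NumberTheory.EllipticCurves.BSDShaProofs
import HarnessLib

/-!
# Route `ByReductionTypeAtTwo`, crux `MultUpperHalfAtTwo` (item stmt-BirchSwinnertonDyer-19922): the four-road
# reduction with the non-split control slot ABSTRACT (`hEC`), and its GUARDED-print instance (audit N-1)

HONEST FRAMING (cell `bsd-2adic`, seat `bsd-2adic-mult-2` GEN 2): research route; nothing is booked; BSD is not
proved by any of this. PARTITION: X5@2 mult (K4ᵐ, B1·O1; 1 976 classes) × p = 2 — types-the-object-of; closes none.

WHY THIS FILE. Every landed road to the upper half of item 19922 (p418902, p420150, p424960, p427239/p429114)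
carries the PRINT binder `h41ns : Greenberg1999.thm41Analogue_charValue_rankZero_numberField_anyPrime` (A235),
used ONLY through the glue `O1.twoAdicEulerCharRankZeroNonsplitMult_zero_of_greenberg` to produce the control
display `O1.TwoAdicEulerCharRankZeroNonsplitMult W 0` (`l_v = 2` at a non-split multiplicative `2`). The cell's
D-audit of A235 (HOME/audit/D-AUDIT-h41-…, verdict V2, recipe N-1; INBOX 06:15Z/06:33Z) found A235, as a
statement over EVERY number field, CONTRADICTED by its source (LNM 1716 §3 Note: `|ker r_v| ≤ 1` when
`(F_∞)_η ⊇ F_v^{unr}`-quadratic), so `(h41ns : A235)` risks VACUITY; the guarded twin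
`…_anyPrime_oddLocalDegree` (p425330) with the primed glue `…_of_greenberg'` (p428013,
`X5/TwoAdicTargetsMultPubOdd.lean`) is the remedy of record. This file re-derives the four roads with the
control slot as an ABSTRACT binder `hEC` (per member) / `hECns` (for every curve) — so that ANY source of the
display (A235, its guarded twin, or a future proof) feeds them — and instantiates them on the guarded twin:

* §1 per member, `hEC`-abstract: `missingUpperBoundAt_two_mult_of_mu_eq_zero_of_eulerChar` (roads i/ii),
  `missingUpperBoundAt_two_nonsplit_of_katoInt_of_eulerChar` (road iii, sharp door),
  `missingUpperBoundAt_two_nonsplit_of_katoMultUpTo_one_of_even_of_eulerChar` (road iv, parity);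
  `missingUpperBoundAt_two_of_isogenous_member` (Cassels transport, shared).
* §2 **`multUpperHalfAtTwo_of_fourRoads_of_eulerChar`** — the FULLY-QUALIFIED route decl ⟸ PRINT ×7 {`h41sp`,
  `hmod`, `hGZK`, `hCassels`, `h514`, `hC`, `hCT`} + the control display for every curve `hECns` + MEMO ×4
  {`hKato`, `hGS`, `hKint`, `hK1`} + the residual `hoff` (= leaf `UpperHalfOffFourRoadsAtMultTwo` verbatim).
* §3 the GUARDED instance `multUpperHalfAtTwo_of_fourRoads'` (`h41ns' : …_oddLocalDegree`) and the glue from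
  leaves `multUpperHalfAtTwo_of_leaves_fourRoads'` — the planner's C1 conjunct should name the guarded constant.

References: [GreenbergLNM1716] §3 Note (p. 93), §4 pp. 112–113, Props. 5.13/5.14; [Kato2004Asterisque] 17.4,
17.11–17.13; [MazurTateTeitelbaum1986Invent] §I.10, §I.14; [SilvermanAEC2009] Thm. X.4.14; [Cesnavicius2018]
Thm. 1.2; [Cassels1965ArithmeticVIII]; [Miller2011LMS] Def. 1.1.
-/

set_option autoImplicit false
set_option linter.dupNamespace false

noncomputable section

open scoped Classical MatrixGroups ModularForm

open CongruenceSubgroup WeierstrassCurve Literature.NumberTheory.EllipticCurves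
  Literature.NumberTheory.EllipticCurves.ModularForms
  Literature.NumberTheory.EllipticCurves.Greenberg1999
  Literature.NumberTheory.EllipticCurves.Rank1Residual
  Literature.NumberTheory.EllipticCurves.Rank1Residual.Typed
  Summit.BirchSwinnertonDyer.Rank1Residual.X5

namespace Summit.BirchSwinnertonDyer.BirchSwinnertonDyer.Theorems

/-! ## §1 Per member, the control slot abstract -/

/-- Cassels transport of the upper half from an isogenous member `W₁` to `W` (analytic rank `0`): class
data by `analyticRank_eq_of_isIsogenous'`, finiteness of `Ш(W₁)` by GZK, `X12.missingUpperBoundAt_of_isIsogenous`.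
[cite: Cassels1965ArithmeticVIII] [cite: Miller2011LMS, §1 and Def. 1.1] -/
theorem missingUpperBoundAt_two_of_isogenous_member (hmod : nonempty_modularParametrizationData)
    (hGZK : rank_eq_analyticRank_of_analyticRank_le_one) (hCassels : bsdRHS_eq_of_isIsogenous)
    (W : WeierstrassCurve ℚ) [W.IsElliptic] [W.IsGloballyMinimal] (hr : W.analyticRank = 0)
    (W₁ : WeierstrassCurve ℚ) [W₁.IsElliptic] [W₁.IsGloballyMinimal] (hiso : IsIsogenous W W₁)
    (hU₁ : MissingUpperBoundAt W₁ 2) : MissingUpperBoundAt W 2 := by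
  have hr₁ : W₁.analyticRank = 0 := (analyticRank_eq_of_isIsogenous' hiso).symm.trans hr
  haveI : NeZero (W₁.conductorNorm ℤ) := ⟨(W₁.conductorNorm_pos_holds).ne'⟩
  obtain ⟨Dm⟩ := hmod W₁
  have hlead₁ : W₁.leadingLCoeff ≠ 0 :=
    W₁.leadingLCoeff_ne_zero_holds Dm.isNewformOf.hasEntireLFunction
  have hfin₁ : Finite W₁.sha := (hGZK W₁ (by rw [hr₁]; exact zero_le_one)).2
  exact Summit.BirchSwinnertonDyer.Rank1Residual.X12.missingUpperBoundAt_of_isIsogenous hCassels hiso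
    hfin₁ hlead₁ hU₁

/-- **Roads (i)/(ii) per member, `hEC`-abstract** — twin of p418902's
`missingUpperBoundAt_two_mult_of_mu_eq_zero_of_period` with the non-split control DISPLAY `hEC :
O1.TwoAdicEulerCharRankZeroNonsplitMult W 0` in place of A235 (the split side keeps A236 `h41sp`): Kato
`⊗ℚ` (`hKato`), `μ = 0` (`hμ`), `0 ≤ ord₂ ϖ` (`hper₀`), Greenberg–Stevens at a split `2` (`hGS`, guarded) ⟹
`MissingUpperBoundAt W 2`. [cite: GreenbergLNM1716, §4 pp. 112–113] [cite: Kato2004Asterisque, Thm. 17.4 and 17.13]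
[cite: Miller2011LMS, Def. 1.1] -/
theorem missingUpperBoundAt_two_mult_of_mu_eq_zero_of_eulerChar (W : WeierstrassCurve ℚ)
    [W.IsElliptic] [W.IsGloballyMinimal] (hKato : O1.KatoMultiplicativeDivisibilityRat W 2)
    (hEC : O1.TwoAdicEulerCharRankZeroNonsplitMult W 0)
    (h41sp : thm41Analogue_charValue_rankZero_split_baseChange_anyPrime)
    (hmod : nonempty_modularParametrizationData)
    (hGZK : rank_eq_analyticRank_of_analyticRank_le_one)
    (hGS : W.HasSplitMultiplicativeReductionAtPrime 2 → greenberg_stevens (W := W) (p := 2))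
    (hμ : ∀ (κ : ZpExtension ℚ 2) (γ : Field.absoluteGaloisGroup ℚ), κ.IsCyclotomic →
      κ.IsTopGenerator γ → IsCyclotomicVariable 2 γ → ∀ D : W.SelmerDualData κ γ, D.mu = 0)
    (hper₀ : ∀ [NeZero (W.conductorNorm ℤ)] (f : CuspForm (Gamma0 (W.conductorNorm ℤ)) 2),
      IsNewformOf W f → ∀ ϖ : ℚ, (ϖ : ℝ) * W.realPeriodRat = plusPeriod f → 0 ≤ padicValRat 2 ϖ)
    (hr : W.analyticRank = 0) (hmult : Mult W 2) : MissingUpperBoundAt W 2 := by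
  by_cases hsp : W.HasSplitMultiplicativeReductionAtPrime 2
  · exact O1.missingUpperBoundAt_two_split_of_mu_eq_zero_auto W
      (O1.twoAdicEulerCharRankZeroSplitMult_zero_of_greenberg W h41sp) hmod hGZK
      (fun f L => O1.katoDivisibilityAtTwoSplitMultRat_of_multRat W hKato f L) hμ
      (O1.kappaOne_binder_of_greenbergStevens W (hGS hsp) hr) hper₀ hr hmult hsp
  · exact O1.missingUpperBoundAt_two_nonsplit_of_mu_eq_zero_auto W hEC hmod hGZK
      (fun f L => O1.katoDivisibilityAtTwoNonsplitMultRat_of_multRat W hKato f L) hμ hper₀ hr hmult hsp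

/-- **Road (iii) per member, `hEC`-abstract** — twin of `O1.missingUpperBoundAt_two_nonsplit_of_katoInt`
(p419632 §4) with the control display `hEC` in place of A235: the sharp door
`O1.KatoDivisibilityAtTwoNonsplitMultInt W` (non-split, `TwoAdicSurjective`, `Δ < 0`) + `hper₀` ⟹
`MissingUpperBoundAt W 2` (`O1.upperBound_two_nonsplit_of_divisibilityRat` at `k = 0`, `ϖ′ = ϖ`).
[cite: GreenbergLNM1716, §4 pp. 112–113] [cite: MazurTateTeitelbaum1986Invent, §I.10 and §I.14] [cite: Miller2011LMS, Def. 1.1] -/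
theorem missingUpperBoundAt_two_nonsplit_of_katoInt_of_eulerChar (W : WeierstrassCurve ℚ) [W.IsElliptic]
    [W.IsGloballyMinimal] (hEC : O1.TwoAdicEulerCharRankZeroNonsplitMult W 0)
    (hmod : nonempty_modularParametrizationData) (hGZK : rank_eq_analyticRank_of_analyticRank_le_one)
    (hKint : O1.KatoDivisibilityAtTwoNonsplitMultInt W)
    (hper₀ : ∀ [NeZero (W.conductorNorm ℤ)] (f : CuspForm (Gamma0 (W.conductorNorm ℤ)) 2),
      IsNewformOf W f → ∀ ϖ : ℚ, (ϖ : ℝ) * W.realPeriodRat = plusPeriod f → 0 ≤ padicValRat 2 ϖ)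
    (hr : W.analyticRank = 0) (hmult : Mult W 2) (hns : ¬ W.HasSplitMultiplicativeReductionAtPrime 2)
    (him : O1.TwoAdicSurjective W) (hΔ : W.Δ < 0) : MissingUpperBoundAt W 2 := by
  haveI : NeZero (W.conductorNorm ℤ) := ⟨(W.conductorNorm_pos_holds).ne'⟩
  obtain ⟨Dm⟩ := hmod W
  have hf : IsNewformOf W Dm.f := Dm.isNewformOf
  have hL : W.entireLFunction 1 ≠ 0 :=
    (W.analyticRank_eq_zero_iff_holds hf.hasEntireLFunction).mp hr
  obtain ⟨ϖ, hϖpos, hϖeq, -⟩ := Dm.exists_rat_mul_realPeriodRat_eq_plusPeriod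
  obtain ⟨κ, hκ, γ, hγ, hγ'⟩ := exists_isCyclotomic_isTopGenerator_isCyclotomicVariable_holds 2
  obtain ⟨D⟩ := W.nonempty_selmerDualData_holds κ γ hγ
  obtain ⟨L, hLf⟩ := exists_isMultPAdicLFunctionOf_neg_one_of_nonsplit hf hmult hns
  obtain ⟨L₀, hL₀⟩ := exists_iwasawaToPowerSeries_eq_C_mul_of_isMultPAdicLFunctionOf_neg_one_two hf
    hmult hns (hper₀ Dm.f hf ϖ hϖeq) hLf
  obtain ⟨hX, hmem⟩ := hKint hmult hns him hΔ Dm.f hf L hLf κ γ hκ hγ hγ' D ϖ hϖeq L₀ hL₀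
  obtain ⟨q, hq, hle⟩ := O1.upperBound_two_nonsplit_of_divisibilityRat W hEC hGZK hmult hns hL hκ hγ
    hγ' hf hLf D ϖ hϖeq hϖpos.ne' 0 (by simp) ⟨hX, L₀, hmem, hL₀⟩
  exact ⟨q, hq, by simpa using hle⟩

/-- `ord_p #Ш` is even for finite `Ш` (Cassels–Tate). Private twin of the Parity file's lemma (that module
imports theorems this file deliberately does not). [cite: SilvermanAEC2009, Thm. X.4.14] -/
private theorem even_padicValNat_shaOrder
    (hCT : WeierstrassCurve.exists_casselsTate_pairing (K := ℚ)) (W : WeierstrassCurve ℚ) [W.IsElliptic]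
    (hfin : Finite W.sha) (p : ℕ) [Fact p.Prime] : Even (padicValNat p W.shaOrder) := by
  have hfin' : W.ShaFinite := hfin
  obtain ⟨r, hr⟩ := WeierstrassCurve.isSquare_shaOrder_of_casselsTate hCT W hfin'
  have hpos : 0 < W.shaOrder := W.shaOrder_pos hfin'
  have hr0 : r ≠ 0 := by
    rintro rfl
    rw [hr, mul_zero] at hpos
    exact lt_irrefl 0 hpos
  exact ⟨padicValNat p r, by rw [hr, padicValNat.mul hr0 hr0]⟩

/-- **Road (iv) per member, `hEC`-abstract** — twin of the Parity file's
`missingUpperBoundAt_two_nonsplit_of_katoMultUpTo_one_of_even`: G1 at slack one `hK1` + Cassels–Tate `hCT` +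
the certificate «`ord₂ #Ш_an(W)` even» + `hC` (period) ⟹ `MissingUpperBoundAt W 2`, with the control display
`hEC` in place of A235. [cite: GreenbergLNM1716, §4 pp. 112–113] [cite: SilvermanAEC2009, Thm. X.4.14]
[cite: Cesnavicius2018, Thm. 1.2] [cite: Miller2011LMS, Def. 1.1] -/
theorem missingUpperBoundAt_two_nonsplit_of_katoMultUpTo_one_of_even_of_eulerChar (W : WeierstrassCurve ℚ)
    [W.IsElliptic] [W.IsGloballyMinimal] (hEC : O1.TwoAdicEulerCharRankZeroNonsplitMult W 0)
    (hmod : nonempty_modularParametrizationData) (hGZK : rank_eq_analyticRank_of_analyticRank_le_one)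
    (hCT : WeierstrassCurve.exists_casselsTate_pairing (K := ℚ))
    (hC : cesnavicius_not_two_dvd_maninConstant_of_two_dvd_level)
    (hK1 : ∀ {N : ℕ} [NeZero N] (f : CuspForm (Gamma0 N) 2) (L : PowerSeries ℚ_[2]),
      O1.KatoDivisibilityAtTwoMultUpTo W 1 f (-1) L)
    (hr : W.analyticRank = 0) (hmult : Mult W 2) (hns : ¬ W.HasSplitMultiplicativeReductionAtPrime 2)
    (him : O1.TwoAdicSurjective W) (heven : ∃ q : ℚ, shaAn W = (q : ℂ) ∧ Even (padicValRat 2 q)) :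
    MissingUpperBoundAt W 2 := by
  haveI : NeZero (W.conductorNorm ℤ) := ⟨(W.conductorNorm_pos_holds).ne'⟩
  obtain ⟨Dm⟩ := hmod W
  have hf : IsNewformOf W Dm.f := Dm.isNewformOf
  have hL : W.entireLFunction 1 ≠ 0 :=
    (W.analyticRank_eq_zero_iff_holds hf.hasEntireLFunction).mp hr
  obtain ⟨ϖ, -, hϖeq, -⟩ := Dm.exists_rat_mul_realPeriodRat_eq_plusPeriod
  obtain ⟨κ, hκ, γ, hγ, hγ'⟩ := exists_isCyclotomic_isTopGenerator_isCyclotomicVariable_holds 2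
  obtain ⟨D⟩ := W.nonempty_selmerDualData_holds κ γ hγ
  obtain ⟨L, hLf⟩ := exists_isMultPAdicLFunctionOf_neg_one_of_nonsplit hf hmult hns
  have hper : padicValRat 2 ϖ = 0 := padicValRat_periodRatio_eq_zero_of_irr_two hC W hmult
    (O1.irr_two_of_twoAdicSurjective W him) Dm.f hf ϖ hϖeq
  obtain ⟨q, hq, hle⟩ := O1.upperBound_two_nonsplit_of_katoMult W hEC hGZK hmult hns hL hκ hγ hγ' hf
    hLf (hK1 Dm.f L) him D ϖ hϖeq 0 (by rw [hper]; norm_num)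
  have hle' : (padicValNat 2 W.shaOrder : ℤ) ≤ padicValRat 2 q + 1 := by simpa using hle
  have hfin : Finite W.sha := (hGZK W (by rw [hr]; exact zero_le_one)).2
  have hevenSha : Even ((padicValNat 2 W.shaOrder : ℕ) : ℤ) :=
    (even_padicValNat_shaOrder hCT W hfin 2).natCast
  obtain ⟨u, hu⟩ := hevenSha
  obtain ⟨q', hq', v, hv⟩ := heven
  have hqq : q' = q := by exact_mod_cast hq'.symm.trans hq
  subst hqq
  exact ⟨q', hq, by omega⟩

/-! ## §2 The crux decl from the four roads, control slot abstract -/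

/-! ### Import refactor H3 (director-bsd 2026-08-26, standing build rule: only an item closer may import a
`…Theses.<Route>` file). The item-closing reductions of this module that CONCLUDE the route declaration
`Theses.ByReductionTypeAtTwo.MultUpperHalfAtTwo` (`multUpperHalfAtTwo_of_fourRoads_of_eulerChar`, `multUpperHalfAtTwo_of_fourRoads'`, `multUpperHalfAtTwo_of_leaves_fourRoads'`) moved VERBATIM to the thin leaf
`Theorems/ByReductionTypeAtTwoMultUpperHalfCloses.lean`; every other declaration is unchanged, so the
certificate towers importing this file (cone ≈ 1 100 modules, 579 under `Rank1Residual/X5/`) no longer rebuild on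
a route edit. -/

end Summit.BirchSwinnertonDyer.BirchSwinnertonDyer.Theorems

end
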